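import Mathlib
import Literature.Computability.AlgebraicComplexity.OrbitCoordinateRing
import Literature.NumberTheory.DiophantineGeometry.GLHighestWeight

/-!
# K2 `PowGenDegreeQP` (stmt-ValiantsHypothesis-11655), line `trace-side-regimes`, row `m = 1`:
# linear forms — substitution on coefficient vectors and the Borel moves

Helper file (`--supports stmt-ValiantsHypothesis-11655`), first of three computing the bottom row
`m = 1` of the window of K2 exactly (`…LinearFormMoves` → `…LinearFormDense` → `…RowOne`).
Elementary linear algebra of linear forms `ℓ = ∑ c_u X_u` on linearly ordered letters with greatest
letter `T`:

* `linSubst_sum_smul_X` — `A · ℓ` has coefficient vector `A c`;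
* `formCoeff_one_sum_smul_X(_eq)` — degree-one coordinates of `Sym¹` are the letters, every point
  of `Sym¹` is the coefficient vector of a linear form;
* `exists_upperTriangular_mulVec_eq` — for `c_T ≠ 0` the UPPER TRIANGULAR matrices
  `1 + (w - c) c_T⁻¹ e_Tᵀ` move `c` to every `w` with `w_T ≠ 0` (the Borel orbit of `ℓ` is all linear
  forms with nonzero top coefficient);
* `exists_upperTriangular_fix_diag` — for `u ≠ T`, `t ≠ 0` the upper triangular
  `1 + (t-1)E_{uu} + (1-t)(c_u/c_T)E_{uT}` FIXES `c` and has diagonal `t` at `u`, `1` elsewhere.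

No orbit closures here; consumed by `…PowGenDegreeQPLinearFormDense.lean`.
-/

namespace Summit.ValiantsHypothesis.ValiantsHypothesis.Theorems.GeneratorObstructions.PowGenDegreeQP

open MvPolynomial
open Literature.NumberTheory.DiophantineGeometry Literature.Computability.AlgebraicComplexity

-- `Summit.ValiantsHypothesis.ValiantsHypothesis.…` is the tree's mandated single-conjunct layout.
set_option linter.dupNamespace false

noncomputable section

/-! ## 1. Linear forms: substitution, coefficients, degree-one coordinates -/

section LinearForms

variable {σ k : Type*} [Fintype σ] [DecidableEq σ] [Field k]

omit [DecidableEq σ] in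
/-- A linear substitution acts on the coefficient vector of a linear form by the matrix:
`A · (∑ c_v X_v) = ∑_u (A c)_u X_u`. [folklore] -/
theorem linSubst_sum_smul_X (A : Matrix σ σ k) (c : σ → k) :
    linSubst σ k A (∑ v, c v • X v) = ∑ u, (A.mulVec c) u • X u := by
  simp only [map_sum, map_smul, linSubst_X, Finset.smul_sum, smul_smul]
  rw [Finset.sum_comm]
  refine Finset.sum_congr rfl fun u _ => ?_
  rw [← Finset.sum_smul, Matrix.mulVec, dotProduct]
  simp only [mul_comm]

omit [Fintype σ] in
/-- A degree-one monomial is a single letter. [folklore] -/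
theorem exists_eq_single_of_degree_eq_one {d : σ →₀ ℕ} (hd : d.degree = 1) :
    ∃ u, d = Finsupp.single u 1 := by
  classical
  have hne : d ≠ 0 := by
    rintro rfl
    simp at hd
  obtain ⟨u, hu⟩ := Finsupp.ne_iff.mp hne
  simp only [Finsupp.coe_zero, Pi.zero_apply] at hu
  refine ⟨u, ?_⟩
  have hle : d u ≤ d.degree := by
    rw [Finsupp.degree]
    exact Finset.single_le_sum (fun _ _ => Nat.zero_le _) (Finsupp.mem_support_iff.mpr hu)
  have hdu : d u = 1 := by omega
  ext v
  by_cases hv : v = u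
  · subst hv; simp [hdu]
  · rw [Finsupp.single_eq_of_ne hv]
    by_contra hv0
    have h2 : d u + d v ≤ d.degree := by
      rw [Finsupp.degree]
      calc d u + d v = ∑ x ∈ ({u, v} : Finset σ), d x := by
            rw [Finset.sum_pair (Ne.symm hv)]
        _ ≤ ∑ x ∈ d.support, d x :=
            Finset.sum_le_sum_of_subset_of_nonneg (by
              intro x hx
              simp only [Finset.mem_insert, Finset.mem_singleton] at hx
              rcases hx with rfl | rfl
              · exact Finsupp.mem_support_iff.mpr hu
              · exact Finsupp.mem_support_iff.mpr hv0) (fun _ _ _ => Nat.zero_le _)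
    omega

/-- Every degree-one coordinate index is a single letter. [folklore] -/
theorem exists_eq_single_of_degIdx_one (d : DegIdx σ 1) : ∃ u, d.1 = Finsupp.single u 1 :=
  exists_eq_single_of_degree_eq_one (mem_degMonomials_iff.mp d.2)

/-- The coefficient vector of `∑ c_v X_v` at the letter `u`. [folklore] -/
theorem formCoeff_one_sum_smul_X (c : σ → k) (d : DegIdx σ 1) {u : σ}
    (hd : d.1 = Finsupp.single u 1) : formCoeff 1 (∑ v, c v • X v) d = c u := by
  rw [formCoeff_apply, hd]
  simp only [coeff_sum, coeff_smul, coeff_X, smul_eq_mul, mul_ite, mul_one, mul_zero]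
  rw [Finset.sum_eq_single u]
  · rw [if_pos rfl]
  · intro v _ hvu
    rw [if_neg]
    intro h
    exact hvu (Finsupp.single_left_injective one_ne_zero h)
  · intro h; exact absurd (Finset.mem_univ u) h

/-- Every point of `Sym¹ = k^{DegIdx σ 1}` is the coefficient vector of a linear form: for
`w_u := p(x_u)`, `formCoeff 1 (∑ w_u X_u) = p`. [folklore] -/
theorem formCoeff_one_sum_smul_X_eq (p : DegIdx σ 1 → k) :
    formCoeff 1 (∑ v, p ⟨Finsupp.single v 1, mem_degMonomials_iff.mpr (Finsupp.degree_single v 1)⟩ •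
      (X v : MvPolynomial σ k)) = p := by
  funext d
  obtain ⟨u, hu⟩ := exists_eq_single_of_degIdx_one d
  rw [formCoeff_one_sum_smul_X _ d hu]
  congr 1
  exact Subtype.ext hu.symm

end LinearForms

/-! ## 2. Borel moves of a linear form with nonzero top coefficient -/

section BorelMoves

variable {σ k : Type*} [Fintype σ] [LinearOrder σ] [Field k]

/-- **Transitivity of the Borel subgroup on linear forms with nonzero top coefficient.** Let `T`
be the greatest letter and `c` a coefficient vector with `c_T ≠ 0`. For every `w` with `w_T ≠ 0`
the matrix `B = 1 + (w - c) c_T⁻¹ e_Tᵀ` is upper triangular, invertible (`det B = w_T / c_T`) and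
`B c = w`. [folklore] -/
theorem exists_upperTriangular_mulVec_eq {T : σ} (hT : ∀ i, i ≤ T) {c : σ → k} (hc : c T ≠ 0)
    {w : σ → k} (hw : w T ≠ 0) :
    ∃ b : GL σ k, IsUpperTriangular b ∧ (b : Matrix σ σ k).mulVec c = w := by
  classical
  set B : Matrix σ σ k :=
    Matrix.of fun u v => (if u = v then (1 : k) else 0) + (if v = T then (w u - c u) / c T else 0)
    with hB
  have hBT : B.BlockTriangular id := by
    intro i j hij
    have hij' : j < i := hij
    have hjT : j ≠ T := fun h => (lt_of_lt_of_le (h ▸ hij') (hT i)).false.elim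
    simp [hB, Matrix.of_apply, ne_of_gt hij', hjT]
  have hdiag : ∀ i, B i i = if i = T then w T / c T else 1 := by
    intro i
    by_cases hi : i = T
    · subst hi
      simp [hB, Matrix.of_apply]
      field_simp
      ring
    · simp [hB, Matrix.of_apply, hi]
  have hdet : B.det = w T / c T := by
    rw [Matrix.det_of_upperTriangular hBT]
    rw [Finset.prod_eq_single T (fun i _ hi => by rw [hdiag, if_neg hi])
      (fun h => absurd (Finset.mem_univ T) h), hdiag, if_pos rfl]
  have hdet0 : B.det ≠ 0 := by
    rw [hdet]
    exact div_ne_zero hw hc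
  refine ⟨Matrix.GeneralLinearGroup.mkOfDetNeZero B hdet0, ?_, ?_⟩
  · change (Matrix.GeneralLinearGroup.mkOfDetNeZero B hdet0 : Matrix σ σ k).BlockTriangular id
    rw [Matrix.GeneralLinearGroup.val_mkOfDetNeZero]
    exact hBT
  · rw [Matrix.GeneralLinearGroup.val_mkOfDetNeZero]
    funext u
    rw [Matrix.mulVec, dotProduct]
    simp only [hB, Matrix.of_apply, add_mul, Finset.sum_add_distrib, ite_mul, one_mul, zero_mul,
      Finset.sum_ite_eq, Finset.mem_univ, if_true]
    rw [Finset.sum_ite_eq' Finset.univ T, if_pos (Finset.mem_univ T)]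
    field_simp
    ring

/-- **Upper triangular stabilisers of a linear form with nonzero top coefficient.** For `u ≠ T`
and `t ≠ 0` the matrix `b_u(t) = 1 + (t-1) E_{uu} + (1-t) (c_u/c_T) E_{uT}` is upper triangular
with diagonal `(1,…,t,…,1)` (`t` at `u`) and fixes the coefficient vector `c`. [folklore] -/
theorem exists_upperTriangular_fix_diag {T : σ} (hT : ∀ i, i ≤ T) {c : σ → k} (hc : c T ≠ 0)
    {u : σ} (hu : u ≠ T) {t : k} (ht : t ≠ 0) :
    ∃ b : GL σ k, IsUpperTriangular b ∧ (b : Matrix σ σ k).mulVec c = c ∧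
      ∀ i, (b : Matrix σ σ k) i i = if i = u then t else 1 := by
  classical
  have huT : u < T := lt_of_le_of_ne (hT u) hu
  set B : Matrix σ σ k :=
    Matrix.of fun x y => (if x = y then (if x = u then t else (1 : k)) else 0) +
      (if x = u ∧ y = T then (1 - t) * c u / c T else 0)
    with hB
  have hBT : B.BlockTriangular id := by
    intro i j hij
    have hij' : j < i := hij
    have hjT : ¬(i = u ∧ j = T) := fun h => (lt_of_lt_of_le (h.2 ▸ hij') (hT i)).false.elim
    simp [hB, Matrix.of_apply, ne_of_gt hij', hjT]
  have hdiag : ∀ i, B i i = if i = u then t else 1 := by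
    intro i
    have hi : ¬(i = u ∧ i = T) := fun h => hu (h.1.symm.trans h.2)
    simp [hB, Matrix.of_apply, hi]
  have hdet : B.det = t := by
    rw [Matrix.det_of_upperTriangular hBT]
    rw [Finset.prod_eq_single u (fun i _ hi => by rw [hdiag, if_neg hi])
      (fun h => absurd (Finset.mem_univ u) h), hdiag, if_pos rfl]
  have hdet0 : B.det ≠ 0 := by rw [hdet]; exact ht
  refine ⟨Matrix.GeneralLinearGroup.mkOfDetNeZero B hdet0, ?_, ?_, ?_⟩
  · change (Matrix.GeneralLinearGroup.mkOfDetNeZero B hdet0 : Matrix σ σ k).BlockTriangular id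
    rw [Matrix.GeneralLinearGroup.val_mkOfDetNeZero]
    exact hBT
  · rw [Matrix.GeneralLinearGroup.val_mkOfDetNeZero]
    funext x
    rw [Matrix.mulVec, dotProduct]
    simp only [hB, Matrix.of_apply, add_mul, Finset.sum_add_distrib, ite_mul, zero_mul,
      Finset.sum_ite_eq, Finset.mem_univ, if_true]
    by_cases hx : x = u
    · subst hx
      simp only [true_and, if_true]
      rw [Finset.sum_ite_eq' Finset.univ T, if_pos (Finset.mem_univ T)]
      field_simp
      ring
    · simp [hx]
  · intro i
    rw [Matrix.GeneralLinearGroup.val_mkOfDetNeZero, hdiag]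

end BorelMoves


end

end Summit.ValiantsHypothesis.ValiantsHypothesis.Theorems.GeneratorObstructions.PowGenDegreeQP
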